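import Summits.BirchSwinnertonDyer.BirchSwinnertonDyer.Theorems.ByReductionTypeAtTwoAdditivePotGoodLowerHalfT0CoinvGenusRow315832c1
import Summits.BirchSwinnertonDyer.BirchSwinnertonDyer.Theorems.ByReductionTypeAtTwoFineSelmerConjAAtTwoAdditivePotGoodCoinvariantGenusCertificate28712Layers
import HarnessLib

/-!
# Route `ByReductionTypeAtTwo` (rung K4), crux C1″ `FineSelmerConjAAtTwoAdditivePotGood` (item stmt-BirchSwinnertonDyer-22615, cc C3″ 22617):
# THE CENSUS ROW `315832c1` (`Δ_cubic < 0`, cubic point field of discriminant `−28712`, `2 = 𝔭²𝔮`, open type) — statement (A)₂ UNCONDITIONALLY: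
# ZERO hypotheses, ZERO named facts (a `--supports 22615` file; seat `bsd-2adic-k4-w1` GEN 12; UPGRADES the instrument-tier reading
# `AddKatoTwo.conjA_two_315832c1_of_rankLe₂` (`rank₂ Cl(ℚ(θ)·ℚ₂) ≤ 2`, PARI/GRH, degree `12`) to KERNEL by the COINVARIANT-GENUS road)

HONEST FRAMING (cell `bsd-2adic`, D-0036/D-0054/D-0152): ONE kernel theorem about ONE curve; closes nothing at the `∀`-level (C1″ 22615 research-open);
nothing booked; BSD for `315832c1` is NOT proved by this (statement (A) is one input of the Kato half at `2`).

THE ROAD (k4-w2 GEN 14 + k4-w1 GEN 12).  `K = ℚ(θ)`, `θ³ − θ² − 24θ + 88 = 0`, `h(K) = 1` (`classNumber_eq_one_of_root_d28712n`), `n₀ = 0`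
(`forall_totallyRamifiedFrom_zero_h315832c1`), two primes above `2`.  Along every cyclotomic `ℤ₂`-extension of `K`: `rank₂ Cl(K₁) ≤ 1` (genus bound
`index_pow_two_mul_le_pow_of_odd_classNumber`), `t ≤ 2` (`ncard_ramified_layer_succ_le_ncard_primes_above`), and `r ≥ 1` — a unit of `K₁` outside
`N_{Gal(K₂/K₁)} K₂ˣ` — from the KERNEL sextic certificate `exists_nonNorm_unit_layers_d28712` (k4-w1 GEN 12: the unit `η′ = 35224 − 16687θ − 9526ω +
(−1505 + 481θ + 310ω)γ` of `𝓞_{K₁}`, `ω = (θ+θ²)/2`, `γ = (1 + √2/π_𝔭)/π_𝔭`, non-norm at the dyadic prime `(√2/π_𝔭)` of ramification index `2` and degree `1`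
by `ε₁ = η′(1 − (2+√2)(√2/π_𝔭)²)π_𝔭² ≡ 1 + ξ⁴ (mod ξ⁵)`); then `rank₂ Cl(K₁) + t ≤ 1 + 2 ≤ 1 + 1 + 1 = c + 1 + r`
(`classicalMuVanishes_of_rank_add_le_layer_succ_succ`, `c = 1 ≤ p − 1`) gives `μ₂(K_cyc) = 0`, and the `Δ < 0` μ-interface `conjA_two_315832c1_of_classicalMu`
(Lim 3.5 at `2` in the kernel, `ℓ = 2` ascent) gives (A)₂ — all packaged by k4-w2's `conjA_two_315832c1_of_layerOneNonNormUnit hθ hunit`, whose ONE displayed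
hypothesis `hunit` is discharged here.

* **`conjA_two_315832c1''`** — (A)₂ for `315832c1` (`[0, 0, 0, 79574117, 176712113750]`), ZERO hypotheses.

References: [CoatesSujatha2005] Conj. A, Thm. 3.4; [Washington1997] §13.1, §13.3 Prop. 13.22–13.23; [Gras2003] IV.4; [Omeara1963] §63B (63:10);
[Lang1990] Ch. 13 §4 Lemma 4.1; [Iwasawa1973MuInvariants] Thm. 2/3.
-/

set_option autoImplicit false
-- sibling precedent: the directory name repeats the summit name
set_option linter.dupNamespace false

noncomputable section

open scoped Classical IntermediateField NumberField nonZeroDivisors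

namespace Summit.BirchSwinnertonDyer.BirchSwinnertonDyer.Theorems.AddKatoTwo

open WeierstrassCurve Field Polynomial IsDedekindDomain NumberField Literature.NumberTheory.EllipticCurves
  Literature.NumberTheory.EllipticCurves.ZpExtension
  Literature.NumberTheory.GaloisRepresentations Literature.NumberTheory.GaloisRepresentations.Herbrand
  Literature.NumberTheory.GaloisRepresentations.MinkowskiUnit Literature.NumberTheory.GaloisRepresentations.CyclicNormIndex
  Literature.NumberTheory.IwasawaTheory Literature.NumberTheory.NumberFields

set_option maxHeartbeats 1600000 in
set_option synthInstance.maxHeartbeats 200000 in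
/-- **UNCONDITIONAL (A)₂ for the census curve `315832c1` — ZERO hypotheses, ZERO named facts.** Coates–Sujatha's statement (A) at `p = 2`: for every
cyclotomic `ℤ₂`-extension of `ℚ` the dual fine Selmer group of `[0, 0, 0, 79574117, 176712113750]` over `ℚ_∞` is finitely generated over `ℤ₂`
(`∃ γ D` currency of C1″).  KERNEL throughout: k4-w2 GEN 14's coinvariant-genus stamp `conjA_two_315832c1_of_layerOneNonNormUnit` (n₀ = 0, `h(ℚ(θ)) = 1`,
`rank₂ Cl(K₁) ≤ 1`, `t ≤ 2`, genus criterion `rank₂ Cl(K₁) + t ≤ 2 + r`) with its ONE displayed hypothesis — a unit of `K₁` that is not a norm from `K₂` —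
discharged by the kernel sextic certificate `exists_nonNorm_unit_layers_d28712` (the unit `η′`, non-norm at the dyadic prime `√2/π_𝔭` with `e = 2`, `f = 1`).
UPGRADES `conjA_two_315832c1_of_rankLe₂`; BSD for `315832c1` is NOT proved by this. [cite: CoatesSujatha2005, Conj. A and Thm. 3.4]
[cite: Washington1997, §13.3 Prop. 13.22–13.23] [cite: Gras2003, IV.4] [cite: Omeara1963, §63B (63:10)] -/
theorem conjA_two_315832c1'' (κ : ZpExtension ℚ 2) (hκ : κ.IsCyclotomic) :
    haveI := (isElliptic_cubicModel _ _ _ (by simp only [Cubic.discr]; norm_num) :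
      (⟨0, ((0 : ℤ) : ℚ), 0, ((79574117 : ℤ) : ℚ), ((176712113750 : ℤ) : ℚ)⟩ : WeierstrassCurve ℚ).IsElliptic)
    ∃ (γ : absoluteGaloisGroup ℚ) (D : (⟨0, ((0 : ℤ) : ℚ), 0, ((79574117 : ℤ) : ℚ), ((176712113750 : ℤ) : ℚ)⟩ : WeierstrassCurve ℚ).FineSelmerDualData κ γ),
      Module.Finite ℤ_[2] (RestrictScalars ℤ_[2] (IwasawaAlgebra 2) D.X) := by
  classical
  haveI : Fact (Nat.Prime 2) := ⟨Nat.prime_two⟩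
  -- a root `θ` of `X³ − X² − 24X + 88`
  obtain ⟨θ, hθ⟩ : ∃ θ : AlgebraicClosure ℚ, aeval θ (Cubic.toPoly ⟨1, ((-1 : ℤ) : ℚ), ((-24 : ℤ) : ℚ), ((88 : ℤ) : ℚ)⟩) = 0 :=
    IsAlgClosed.exists_aeval_eq_zero _ _ (by rw [Cubic.degree_of_a_ne_zero one_ne_zero]; norm_num)
  refine conjA_two_315832c1_of_layerOneNonNormUnit hθ ?_ κ hκ
  intro κL hκL
  haveI : FiniteDimensional ℚ (IntermediateField.adjoin ℚ {θ}) :=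
    IntermediateField.adjoin.finiteDimensional ((AlgebraicClosure.isAlgebraic ℚ).isAlgebraic θ).isIntegral
  haveI : NumberField (IntermediateField.adjoin ℚ {θ}) := NumberField.mk
  have h3 := finrank_adjoin_eq_three_of_irreducible irreducible_cubic_h315832c1 hθ
  obtain ⟨b, -, hb⟩ := exists_ringOfIntegers_cubic_root (p := -1) (q := -24) (r := 88) hθ
  haveI : FiniteDimensional (IntermediateField.adjoin ℚ {θ}) (κL.layer (0 + 1)) := κL.finiteDimensional_layer_holds _
  haveI : FiniteDimensional (IntermediateField.adjoin ℚ {θ}) (κL.layer (0 + (1 + 1))) := κL.finiteDimensional_layer_holds _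
  haveI : NumberField (κL.layer (0 + 1)) := NumberField.of_module_finite (IntermediateField.adjoin ℚ {θ}) (κL.layer (0 + 1))
  haveI : NumberField (κL.layer (0 + (1 + 1))) := NumberField.of_module_finite (IntermediateField.adjoin ℚ {θ}) (κL.layer (0 + (1 + 1)))
  have hML : κL.layer (0 + 1) ≤ κL.layer (0 + (1 + 1)) := κL.layer_mono (by omega)
  letI : Algebra (κL.layer (0 + 1)) (κL.layer (0 + (1 + 1))) := (IntermediateField.inclusion hML).toRingHom.toAlgebra
  haveI : IsScalarTower (IntermediateField.adjoin ℚ {θ}) (κL.layer (0 + 1)) (κL.layer (0 + (1 + 1))) :=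
    IsScalarTower.of_algebraMap_eq fun x => ((IntermediateField.inclusion hML).commutes x).symm
  exact exists_nonNorm_unit_layers_d28712 (IntermediateField.adjoin ℚ {θ}) h3 b hb κL hκL

end Summit.BirchSwinnertonDyer.BirchSwinnertonDyer.Theorems.AddKatoTwo

end
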